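import Summits.Ventures.Crystal3D.Theorems.StickyWulffConstantTextureLiminfTexShadowCoverageBarlowDefs
import Summits.Ventures.Crystal3D.Theorems.StickyWulffConstantTextureLiminfLineCountGlueOneSided
import Summits.Ventures.Crystal3D.Theorems.StickyWulffConstantTextureLiminfTexShadowWalkerCoveredGlue
import Summits.Ventures.Crystal3D.Theorems.StickyWulffConstantGenericWallFloorOfP5Exhaustion
import Summits.Ventures.Crystal3D.Theorems.StickyWulffConstantGenericWallFloorStarPairFar
import HarnessLib

/-!
# TexShadow row (e), K3 glue: the faulted residual CORE from a Barlow one-sided coverage certificate, by lane G's K1a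
# (lane T, crux `TextureLiminfV5`, stmt-Ventures-23912; cf-p1 g31 «g11 QUEUE OF RECORD» (ii); pattern of `twoSlabLedgerWith_all_of_coverage` p687120)

HONEST FRAMING. Venture `Summits/Ventures/Crystal3D` (cell `crystal3d-full`), route `route-Ventures-StickyWulffConstant`, helper
`--supports` the law-v5 crux `TextureLiminfV5` (stmt-Ventures-23912), registered line `TexShadow` v8.2, stub `stub_residualFaultedCore`.
PURE BOOKKEEPING (census-free, standard axioms): every wall input is a HYPOTHESIS — E1 in `ExactOnly` form (or `P5Exhaustion`), the star facts
(or `StarPairFar`), a certificate `ResidualOneSidedCoverageBarlowOn Reg c₀`, and the remainder stub on the complementary region.  No certificate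
is proved or claimed; rung F-C1 not moved.

WHAT.
* `bilayerWallAt_of_barlowUpCertified` — a pair whose UP family is certified at charge `c₀` (`BarlowUpCertified c₀ σ₁ L₁ L₂`: plate 1 flux-feasible
  toward `e₃`, canonical zig frames apart from plate 2's two presented lattices) satisfies the cell at
  `C(R₀) = (318 + 192R₀ + 80(R₀+9) + 3456 + 1152(R₀+1))/2`, `R₀ ≥ 6`, for EVERY nonnegative table bounded by `c₀`: K1a
  `barlow_hlines_oriented_oneSided` (p691515) on the UP-PRESENTATION `(upFrame L₁ e₃, upWord L₁ σ₁ e₃)` of plate 1 (plate 2 as presented),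
  selectors transported back by `selector_of_upFrame`, the plate re-described by `stacking_upFrame`, and wulff-p2's one-family cell glue
  `bilayerWallAt_of_lineCount_oneSided` (p692930) at launch threshold `τ₀ = √2·c₀` (flux-feasibility makes the plate launchable and gives
  `c ≤ c₀ ≤ plateFlux/2` strip by strip); `bilayerWallAt_of_barlowDownCertified` — the mirror statement (plate 2 toward `−e₃`, `…_top`).
* `faultedOnAt_of_coverageBarlowOn` — a certificate on `Reg` gives `BilayerWallFaultedOnAt Reg c₀ C(R₀) R₀` (the WHOLE cell law on `Reg`, faulted
  pairs; the residual class, the frames and the axes are idle).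
* `residualFaultedCoreAt_of_split` — on-`Reg` law + core-on-`Rem` + `Reg ∨ Rem` everywhere ⇒ the registered core `BilayerWallResidualFaultedCoreAt`.
* `residualFaultedCoreAt_of_coverageBarlowOn` / `…_of_coverageBarlow` (`P5Exhaustion`, `StarPairFar` by name) — THE ROW-(e) CLOSER:
  `stub_residualFaultedCore` at `(13/25, 10)` from {E1, StarPairFar, `ResidualOneSidedCoverageBarlow (13/25)`, K4 `∃ C, BilayerWallResidualFaultedEdgeOnAt
  (13/25) C 10`} (`stub_residualFaultedCore_of_coverageBarlow`).
WHAT THIS IS NOT: no certificate, no K4; chosen slots / K1b not consumed; F-C1 not moved.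
-/

noncomputable section

namespace Summit.Ventures.Crystal3D.Cruxes.TextureLiminf.TexShadow

open Summit.Ventures.Crystal3D Summit.Ventures.Crystal3D.Theorems Finset
open Literature.MathematicalPhysics.StatisticalMechanics (IsHaggSeq fccStacking barlowStacking basalMirror triangularVec₁ triangularVec₂)
open scoped InnerProductSpace

/-! ## Arithmetic of the flux test -/

/-- `√2·c₀ ≤ r` gives `c₀ ≤ √2·r/2` (local copy of lane G's `charge_le_of_sqrt_two_mul_le`). -/
private theorem le_sqrt_two_mul_div_two {c₀ r : ℝ} (h : Real.sqrt 2 * c₀ ≤ r) : c₀ ≤ Real.sqrt 2 * r / 2 := by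
  have h2 : Real.sqrt 2 * Real.sqrt 2 = 2 := Real.mul_self_sqrt (by norm_num)
  have hnn : 0 ≤ Real.sqrt 2 / 2 * (r - Real.sqrt 2 * c₀) :=
    mul_nonneg (div_nonneg (Real.sqrt_nonneg 2) zero_le_two) (sub_nonneg.2 h)
  have hid : Real.sqrt 2 * r / 2 - c₀ = Real.sqrt 2 / 2 * (r - Real.sqrt 2 * c₀) := by
    linear_combination (c₀ / 2) * h2
  linarith [hid, hnn]

/-- **Flux-feasibility dominates every table bounded by `c₀`** (plate 1 toward `e₃`, launch threshold `τ₀ = √2·c₀`):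
`c i j ≤ c₀ ≤ plateFlux (√2c₀) L₁ σ₁ e₃ i / 2`. -/
theorem dom_of_fluxFeasible {c₀ : ℝ} {L : E3 ≃ₗᵢ[ℝ] E3} {σ : ℤ → ℤ} {e : E3} (h : FluxFeasible c₀ L σ e)
    {c : ℤ → ℤ → ℝ} (hcc : ∀ i j, c i j ≤ c₀) (i j : ℤ) : c i j ≤ plateFlux (Real.sqrt 2 * c₀) L σ e i / 2 := by
  have hlaunch : PlateLaunchable (Real.sqrt 2 * c₀) L σ e := ⟨0, h.2 0⟩
  unfold plateFlux
  rw [if_pos hlaunch]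
  exact (hcc i j).trans (le_sqrt_two_mul_div_two (h.2 i))

/-! ## One certified family ⇒ the cell (K1a + selector transport + the one-family cell glue) -/

/-- **UP family certified ⇒ the cell**, for every nonnegative table bounded by `c₀` (`R₀ ≥ 6`). -/
theorem bilayerWallAt_of_barlowUpCertified {sE : E3} (hsE : sE ∈ fccSlots) (hcert : ExactOnly 0 (fccSlots.filter fun w => 0 < ⟪w, sE⟫_ℝ))
    (hDS : ∀ F₁ F₂ : E3 ≃ₗᵢ[ℝ] E3, DoubleStarCoaxialAt F₁ F₂) (hCP : CapPairCoaxial)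
    {σ₁ σ₂ : ℤ → ℤ} (hσ₁ : IsHaggSeq σ₁) (hσ₂ : IsHaggSeq σ₂) (L₁ L₂ : E3 ≃ₗᵢ[ℝ] E3) (s₁ s₂ : E3)
    {c₀ : ℝ} (hcov : BarlowUpCertified c₀ σ₁ L₁ L₂) (R₀ : ℝ) (hR₀ : 6 ≤ R₀)
    (c : ℤ → ℤ → ℝ) (hc0 : ∀ i j, 0 ≤ c i j) (hcc : ∀ i j, c i j ≤ c₀) :
    BilayerWallAt ((318 + 192 * R₀ + 80 * (R₀ + 9) + 3456 + 1152 * (R₀ + 1)) / 2) R₀ σ₁ σ₂ L₁ L₂ s₁ s₂ c := by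
  obtain ⟨hff, hapart⟩ := hcov
  have hσ₁' : IsHaggSeq (upWord L₁ σ₁ e₃) := isHaggSeq_upWord L₁ hσ₁ e₃
  have hax₁ : 0 ≤ ((upFrame L₁ e₃).symm e₃) 2 := upFrame_axis_nonneg L₁ e₃
  have hsteep₁ : Real.sqrt 2 / 2 ≤
      ⟪upFrame L₁ e₃ (best3 (fun w => ⟪w, (upFrame L₁ e₃).symm e₃⟫_ℝ) upSlot₁ upSlot₂ upSlot₃), e₃⟫_ℝ :=
    famSlot_steep_of_deltaSteep L₁ e₃ hff.1
  have hapart₁ : ∀ F ∈ chainFrames e₃ (upFrame L₁ e₃) (best3 (fun w => ⟪w, (upFrame L₁ e₃).symm e₃⟫_ℝ) upSlot₁ upSlot₂ upSlot₃),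
      F '' fccStacking 1 (Real.sqrt (2 / 3)) ≠ L₂ '' fccStacking 1 (Real.sqrt (2 / 3)) ∧
      F '' fccStacking 1 (Real.sqrt (2 / 3)) ≠ (twinFrame L₂ (L₂ e₃)) '' fccStacking 1 (Real.sqrt (2 / 3)) := hapart
  obtain ⟨step₁', hsel₁', hF'⟩ :=
    barlow_hlines_oriented_oneSided hsE hcert hDS hCP hσ₁' hσ₂ (upFrame L₁ e₃) L₂ s₁ s₂ hax₁ hsteep₁ hapart₁ R₀ hR₀
  obtain ⟨step₁, hsel₁, heq₁⟩ := selector_of_upFrame L₁ hσ₁ e₃ s₁ hsel₁'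
  refine bilayerWallAt_of_lineCount_oneSided hσ₁ hσ₂ L₁ L₂ s₁ s₂ (Real.sqrt 2 * c₀) R₀ (318 + 192 * R₀) (by linarith) c hc0
    (dom_of_fluxFeasible hff hcc) hsel₁ ?_
  intro h hh ρ hρ X P₁ P₂ hX hP₁X hP₂X hcyl hP₁ hP₂
  have hP₁' : ∀ p, p ∈ P₁ ↔ (p ∈ stacking (upFrame L₁ e₃) s₁ (upWord L₁ σ₁ e₃) ∧ -(2 * R₀) ≤ p 2 ∧ p 2 ≤ -R₀ ∧
      p 0 ^ 2 + p 1 ^ 2 ≤ ρ ^ 2) := fun p => by rw [stacking_upFrame]; exact hP₁ p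
  obtain ⟨m', T₁, hm', hT₁, hcount⟩ := hF' h hh ρ hρ X P₁ P₂ hX hP₁X hP₂X hcyl hP₁' hP₂
  refine ⟨m', T₁, hm', ?_, hcount⟩
  rintro t ⟨k, hk⟩
  refine hT₁ t ⟨k, ?_⟩
  rw [heq₁ k t]
  exact hk

/-- **DOWN family certified ⇒ the cell**, for every nonnegative table bounded by `c₀` (`R₀ ≥ 6`; plate 2 toward `−e₃`, `…_top`). -/
theorem bilayerWallAt_of_barlowDownCertified {sE : E3} (hsE : sE ∈ fccSlots) (hcert : ExactOnly 0 (fccSlots.filter fun w => 0 < ⟪w, sE⟫_ℝ))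
    (hDS : ∀ F₁ F₂ : E3 ≃ₗᵢ[ℝ] E3, DoubleStarCoaxialAt F₁ F₂) (hCP : CapPairCoaxial)
    {σ₁ σ₂ : ℤ → ℤ} (hσ₁ : IsHaggSeq σ₁) (hσ₂ : IsHaggSeq σ₂) (L₁ L₂ : E3 ≃ₗᵢ[ℝ] E3) (s₁ s₂ : E3)
    {c₀ : ℝ} (hcov : BarlowDownCertified c₀ σ₂ L₁ L₂) (R₀ : ℝ) (hR₀ : 6 ≤ R₀)
    (c : ℤ → ℤ → ℝ) (hc0 : ∀ i j, 0 ≤ c i j) (hcc : ∀ i j, c i j ≤ c₀) :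
    BilayerWallAt ((318 + 192 * R₀ + 80 * (R₀ + 9) + 3456 + 1152 * (R₀ + 1)) / 2) R₀ σ₁ σ₂ L₁ L₂ s₁ s₂ c := by
  obtain ⟨hff, hapart⟩ := hcov
  have hσ₂' : IsHaggSeq (upWord L₂ σ₂ (-e₃)) := isHaggSeq_upWord L₂ hσ₂ (-e₃)
  have hax₂ : 0 ≤ ((upFrame L₂ (-e₃)).symm (-e₃)) 2 := upFrame_axis_nonneg L₂ (-e₃)
  have hsteep₂ : Real.sqrt 2 / 2 ≤
      ⟪upFrame L₂ (-e₃) (best3 (fun w => ⟪w, (upFrame L₂ (-e₃)).symm (-e₃)⟫_ℝ) upSlot₁ upSlot₂ upSlot₃), -e₃⟫_ℝ :=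
    famSlot_steep_of_deltaSteep L₂ (-e₃) hff.1
  have hapart₂ : ∀ F ∈ chainFrames (-e₃) (upFrame L₂ (-e₃))
      (best3 (fun w => ⟪w, (upFrame L₂ (-e₃)).symm (-e₃)⟫_ℝ) upSlot₁ upSlot₂ upSlot₃),
      F '' fccStacking 1 (Real.sqrt (2 / 3)) ≠ L₁ '' fccStacking 1 (Real.sqrt (2 / 3)) ∧
      F '' fccStacking 1 (Real.sqrt (2 / 3)) ≠ (twinFrame L₁ (L₁ e₃)) '' fccStacking 1 (Real.sqrt (2 / 3)) := hapart
  obtain ⟨step₂', hsel₂', hF'⟩ :=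
    barlow_hlines_oriented_oneSided_top hsE hcert hDS hCP hσ₁ hσ₂' L₁ (upFrame L₂ (-e₃)) s₁ s₂ hax₂ hsteep₂ hapart₂ R₀ hR₀
  obtain ⟨step₂, hsel₂, heq₂⟩ := selector_of_upFrame L₂ hσ₂ (-e₃) s₂ hsel₂'
  refine bilayerWallAt_of_lineCount_oneSided_top hσ₁ hσ₂ L₁ L₂ s₁ s₂ (Real.sqrt 2 * c₀) R₀ (318 + 192 * R₀) (by linarith) c hc0
    (fun i j => dom_of_fluxFeasible (c := fun j i => c i j) hff (fun j i => hcc i j) j i) hsel₂ ?_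
  intro h hh ρ hρ X P₁ P₂ hX hP₁X hP₂X hcyl hP₁ hP₂
  have hP₂' : ∀ p, p ∈ P₂ ↔ (p ∈ stacking (upFrame L₂ (-e₃)) s₂ (upWord L₂ σ₂ (-e₃)) ∧ h + R₀ ≤ p 2 ∧ p 2 ≤ h + 2 * R₀ ∧
      p 0 ^ 2 + p 1 ^ 2 ≤ ρ ^ 2) := fun p => by rw [stacking_upFrame]; exact hP₂ p
  obtain ⟨m', T₂, hm', hT₂, hcount⟩ := hF' h hh ρ hρ X P₁ P₂ hX hP₁X hP₂X hcyl hP₁ hP₂'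
  refine ⟨m', T₂, hm', ?_, hcount⟩
  rintro t ⟨k, hk⟩
  refine hT₂ t ⟨k, ?_⟩
  rw [heq₂ k t]
  exact hk

/-- **One-sidedly certified ⇒ the cell.** -/
theorem bilayerWallAt_of_barlowOneSidedCertified {sE : E3} (hsE : sE ∈ fccSlots)
    (hcert : ExactOnly 0 (fccSlots.filter fun w => 0 < ⟪w, sE⟫_ℝ))
    (hDS : ∀ F₁ F₂ : E3 ≃ₗᵢ[ℝ] E3, DoubleStarCoaxialAt F₁ F₂) (hCP : CapPairCoaxial)
    {σ₁ σ₂ : ℤ → ℤ} (hσ₁ : IsHaggSeq σ₁) (hσ₂ : IsHaggSeq σ₂) (L₁ L₂ : E3 ≃ₗᵢ[ℝ] E3) (s₁ s₂ : E3)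
    {c₀ : ℝ} (hcov : BarlowOneSidedCertified c₀ σ₁ σ₂ L₁ L₂) (R₀ : ℝ) (hR₀ : 6 ≤ R₀)
    (c : ℤ → ℤ → ℝ) (hc0 : ∀ i j, 0 ≤ c i j) (hcc : ∀ i j, c i j ≤ c₀) :
    BilayerWallAt ((318 + 192 * R₀ + 80 * (R₀ + 9) + 3456 + 1152 * (R₀ + 1)) / 2) R₀ σ₁ σ₂ L₁ L₂ s₁ s₂ c := by
  rcases hcov with hup | hdown
  · exact bilayerWallAt_of_barlowUpCertified hsE hcert hDS hCP hσ₁ hσ₂ L₁ L₂ s₁ s₂ hup R₀ hR₀ c hc0 hcc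
  · exact bilayerWallAt_of_barlowDownCertified hsE hcert hDS hCP hσ₁ hσ₂ L₁ L₂ s₁ s₂ hdown R₀ hR₀ c hc0 hcc

/-! ## A certificate on `Reg` ⇒ the whole cell law on `Reg` (faulted pairs) -/

/-- **Certificate on `Reg` ⇒ `BilayerWallFaultedOnAt Reg c₀ C(R₀) R₀`** (`R₀ ≥ 6`): the residual class, the bilayer frames and the axes are idle;
only `0 ≤ c ≤ c₀` of admissibility is used. -/
theorem faultedOnAt_of_coverageBarlowOn {sE : E3} (hsE : sE ∈ fccSlots) (hcert : ExactOnly 0 (fccSlots.filter fun w => 0 < ⟪w, sE⟫_ℝ))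
    (hDS : ∀ F₁ F₂ : E3 ≃ₗᵢ[ℝ] E3, DoubleStarCoaxialAt F₁ F₂) (hCP : CapPairCoaxial)
    {Reg : (ℤ → ℤ) → (ℤ → ℤ) → (E3 ≃ₗᵢ[ℝ] E3) → (E3 ≃ₗᵢ[ℝ] E3) → Prop} {c₀ : ℝ}
    (hcov : ResidualOneSidedCoverageBarlowOn Reg c₀) {R₀ : ℝ} (hR₀ : 6 ≤ R₀) :
    BilayerWallFaultedOnAt Reg c₀ ((318 + 192 * R₀ + 80 * (R₀ + 9) + 3456 + 1152 * (R₀ + 1)) / 2) R₀ := by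
  intro σ₁ σ₂ hσ₁ hσ₂ hf L₁ L₂ s₁ s₂ A₁ A₂ u₁ u₂ _ _ hreg c m hadm
  exact bilayerWallAt_of_barlowOneSidedCertified hsE hcert hDS hCP hσ₁ hσ₂ L₁ L₂ s₁ s₂ (hcov σ₁ σ₂ hσ₁ hσ₂ hf L₁ L₂ hreg)
    R₀ hR₀ c hadm.1 hadm.2.1

/-! ## Splitting the core along a regime -/

open scoped Classical in
/-- **The core from its two halves**: the on-`Reg` law, the core on `Rem`, and `Reg ∨ Rem` for every presented pair give the registered core
`BilayerWallResidualFaultedCoreAt c₀ (max C₁ C₂) R₀` (`R₀ ≥ 0`). -/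
theorem residualFaultedCoreAt_of_split
    {Reg Rem : (ℤ → ℤ) → (ℤ → ℤ) → (E3 ≃ₗᵢ[ℝ] E3) → (E3 ≃ₗᵢ[ℝ] E3) → Prop}
    (hcover : ∀ σ₁ σ₂ L₁ L₂, Reg σ₁ σ₂ L₁ L₂ ∨ Rem σ₁ σ₂ L₁ L₂) {c₀ C₁ C₂ R₀ : ℝ} (hR₀ : 0 ≤ R₀)
    (h₁ : BilayerWallFaultedOnAt Reg c₀ C₁ R₀) (h₂ : BilayerWallResidualFaultedCoreOnAt Rem c₀ C₂ R₀) :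
    BilayerWallResidualFaultedCoreAt c₀ (max C₁ C₂) R₀ := by
  intro σ₁ σ₂ hσ₁ hσ₂ hf L₁ L₂ s₁ s₂ A₁ A₂ u₁ u₂ hA₁ hA₂ hres c m hadm hleaf
  rcases hcover σ₁ σ₂ L₁ L₂ with hreg | hrem
  · exact bilayerWallAt_mono hR₀ (le_max_left _ _) (h₁ σ₁ σ₂ hσ₁ hσ₂ hf L₁ L₂ s₁ s₂ A₁ A₂ u₁ u₂ hA₁ hA₂ hreg c m hadm)
  · exact bilayerWallAt_mono hR₀ (le_max_right _ _)
      (h₂ σ₁ σ₂ hσ₁ hσ₂ hf L₁ L₂ s₁ s₂ A₁ A₂ u₁ u₂ hA₁ hA₂ hres hrem c m hadm hleaf)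

/-- **THE ROW-(e) CLOSER, `ExactOnly` form**: E1-data, the star facts, a certificate on `Reg`, and the core on a region `Rem` covering the complement
of `Reg`, give the registered core (`R₀ ≥ 6`). -/
theorem residualFaultedCoreAt_of_coverageBarlowOn {sE : E3} (hsE : sE ∈ fccSlots)
    (hcert : ExactOnly 0 (fccSlots.filter fun w => 0 < ⟪w, sE⟫_ℝ))
    (hDS : ∀ F₁ F₂ : E3 ≃ₗᵢ[ℝ] E3, DoubleStarCoaxialAt F₁ F₂) (hCP : CapPairCoaxial)
    {Reg Rem : (ℤ → ℤ) → (ℤ → ℤ) → (E3 ≃ₗᵢ[ℝ] E3) → (E3 ≃ₗᵢ[ℝ] E3) → Prop}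
    (hcover : ∀ σ₁ σ₂ L₁ L₂, Reg σ₁ σ₂ L₁ L₂ ∨ Rem σ₁ σ₂ L₁ L₂) {c₀ : ℝ} (hcov : ResidualOneSidedCoverageBarlowOn Reg c₀)
    {R₀ : ℝ} (hR₀ : 6 ≤ R₀) (hrem : ∃ C : ℝ, BilayerWallResidualFaultedCoreOnAt Rem c₀ C R₀) :
    ∃ C : ℝ, BilayerWallResidualFaultedCoreAt c₀ C R₀ := by
  obtain ⟨C₂, h₂⟩ := hrem
  exact ⟨_, residualFaultedCoreAt_of_split hcover (by linarith) (faultedOnAt_of_coverageBarlowOn hsE hcert hDS hCP hcov hR₀) h₂⟩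

/-- **THE ROW-(e) CLOSER, named-fact form**: `P5Exhaustion → StarPairFar → ResidualOneSidedCoverageBarlowOn Reg c₀ →
(∃ C, core on Rem) → ∃ C, BilayerWallResidualFaultedCoreAt c₀ C R₀` whenever `Reg ∨ Rem` exhausts the pairs (`R₀ ≥ 6`). -/
theorem residualFaultedCoreAt_of_coverageBarlowOn' (hE1 : P5Exhaustion) (hSP : StarPairFar)
    {Reg Rem : (ℤ → ℤ) → (ℤ → ℤ) → (E3 ≃ₗᵢ[ℝ] E3) → (E3 ≃ₗᵢ[ℝ] E3) → Prop}
    (hcover : ∀ σ₁ σ₂ L₁ L₂, Reg σ₁ σ₂ L₁ L₂ ∨ Rem σ₁ σ₂ L₁ L₂) {c₀ : ℝ} (hcov : ResidualOneSidedCoverageBarlowOn Reg c₀)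
    {R₀ : ℝ} (hR₀ : 6 ≤ R₀) (hrem : ∃ C : ℝ, BilayerWallResidualFaultedCoreOnAt Rem c₀ C R₀) :
    ∃ C : ℝ, BilayerWallResidualFaultedCoreAt c₀ C R₀ := by
  obtain ⟨sE, hsE, hcert⟩ := exactOnly_star_of_p5Exhaustion hE1
  exact residualFaultedCoreAt_of_coverageBarlowOn hsE hcert (doubleStarCoaxialAt_of_starPairFar hSP)
    (capPairCoaxial_of_starPairFar hSP) hcover hcov hR₀ hrem

/-! ## The candidate instance: `Reg := ¬ EdgeOn`, remainder K4 -/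

open scoped Classical in
/-- **Core = certificate outside edge-on + K4**: `P5Exhaustion → StarPairFar → ResidualOneSidedCoverageBarlow c₀ →
(∃ C, BilayerWallResidualFaultedEdgeOnAt c₀ C R₀) → ∃ C, BilayerWallResidualFaultedCoreAt c₀ C R₀` (`R₀ ≥ 6`). -/
theorem residualFaultedCoreAt_of_coverageBarlow (hE1 : P5Exhaustion) (hSP : StarPairFar) {c₀ : ℝ}
    (hcov : ResidualOneSidedCoverageBarlow c₀) {R₀ : ℝ} (hR₀ : 6 ≤ R₀)
    (hK4 : ∃ C : ℝ, BilayerWallResidualFaultedEdgeOnAt c₀ C R₀) :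
    ∃ C : ℝ, BilayerWallResidualFaultedCoreAt c₀ C R₀ :=
  residualFaultedCoreAt_of_coverageBarlowOn' hE1 hSP (Rem := EdgeOnAt c₀) (fun σ₁ σ₂ L₁ L₂ => (em (EdgeOnAt c₀ σ₁ σ₂ L₁ L₂)).symm)
    hcov hR₀ hK4

/-- **`stub_residualFaultedCore` of TexShadow v8.2 BY NAME modulo {E1, StarPairFar, the candidate certificate at `13/25`, K4 at `(13/25, 10)`}.** -/
theorem stub_residualFaultedCore_of_coverageBarlow (hE1 : P5Exhaustion) (hSP : StarPairFar)
    (hcov : ResidualOneSidedCoverageBarlow (13 / 25)) (hK4 : ∃ C : ℝ, BilayerWallResidualFaultedEdgeOnAt (13 / 25) C 10) :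
    ∃ C : ℝ, BilayerWallResidualFaultedCoreAt (13 / 25) C 10 :=
  residualFaultedCoreAt_of_coverageBarlow hE1 hSP hcov (by norm_num) hK4

end Summit.Ventures.Crystal3D.Cruxes.TextureLiminf.TexShadow

end
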